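import Summits.CriticalPhenomena.CardyFormulaZ2.Theorems.CardyWhiteToColouredSimilarityUpgradeStubIncrementExtraction
import Summits.CriticalPhenomena.CardyFormulaZ2.Theorems.CardyWhiteToColouredSimilarityUpgradeStubCornerArm
import Summits.CriticalPhenomena.CardyFormulaZ2.Theorems.CardyWhiteToColouredSimilarityUpgradeStubIncrementBound
import Summits.CriticalPhenomena.CardyFormulaZ2.Theorems.CardyWhiteToColouredSimilarityUpgradeStubIncrementLimit
import Summits.CriticalPhenomena.CardyFormulaZ2.Theorems.CardyWhiteToColouredSimilarityUpgradeStubRectangleContinuity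

/-!
# No jump of the bond-ℤ² box-crossing limit in the aspect ratio (H1 of line `registered`,
crux `SimilarityUpgrade`, stmt-CriticalPhenomena-4597)

Route `CardyWhiteToColoured`, sub-problem `CardyFormulaZ2`. This file ASSEMBLES, by name and
without `sorry`, the five landed stubs of the regularity half H1 of the reshaped line:

* `stub_incrementExtraction` (T1, deterministic): on `LR(m,k) ∖ LR(m+j,k)` the topmost of the
  rightmost sites joined inside `[0,m+j]×[0,k]` to its left side is a local top in direction
  `(1,0)` (`IsLocalTop`, `ClusterExtremalPoints.lean`) at every admissible scale, or sits near a
  corner;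
* `stub_cornerArm` (T2): the corner one-arm bound (`annulusOpenCrossing_half_le_holds`);
* `stub_incrementBound` (A1): the union bound with `real_localTopEvent_le` (extremal points of
  clusters are rare, `≤ C/s²` — the counting argument behind the universal half-plane three-arm
  exponent `2`): `crossingProb half m k - crossingProb half (m+j) k ≤ C j (k+1)/s² + C ((j+s)/m)^α`;
* `stub_incrementLimit` (A2): the ε-form (`s ≍ ε^{1/3} k`);
* `stub_rectangleContinuity` (T3): with c1's exact identification `RectangleDuality.bond_lr_eq`,
  continuity of `w ↦ Φ (Q w)` on `(0, ∞)` for every full-limit `Φ` and every left–right box family.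

Results: `crossingProb_uniformIncrement` (adding `≤ ε k` columns to a box of comparable sides moves
the critical crossing probability by at most `η`, uniformly in `k ≥ k₀` — a mesh-uniform
equicontinuity statement of independent interest, cf. Schramm–Smirnov 2011, Lemma 6.1) and
`rectangleContinuity` (H1). With these, the crux `SimilarityUpgrade` is reduced to the heart H3
alone (`SimilarityUpgradeReduction.similarityUpgrade_of_rectilinearHeart`, sibling file
`…SimilarityUpgradeOfRectilinearHeart.lean`).

References: O. Schramm, S. Smirnov, Ann. Probab. 39 (2011), §6; P. Nolin, EJP 13 (2008), §5.2;
B. Bollobás, O. Riordan, *Percolation* (2006), Ch. 3 and Ch. 7.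
-/

noncomputable section

namespace Summit.CriticalPhenomena.CardyFormulaZ2.Cruxes.SimilarityUpgrade.Stubs

open Filter Topology Set
open Literature.Probability.RandomPlanarGeometry
open Literature.Probability.Percolation

/-- **Mesh-uniform equicontinuity of critical box crossings in the width** (T1 + T2 + A1 + A2, by
name): for every aspect window `a k ≤ m ≤ k / a` and every `η > 0` there are `ε > 0` and `k₀` such
that adding at most `ε k` columns to the box `[0,m]×[0,k]` changes the `P_{1/2}`-probability of an
open left–right crossing by at most `η`, for all `k ≥ k₀`. [cite: SchrammSmirnov2011, Lemma 6.1]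
[cite: Nolin2008, §5.2 proof of Thm 23] -/
theorem crossingProb_uniformIncrement :
    ∀ a : ℝ, 0 < a → ∀ η : ℝ, 0 < η → ∃ ε : ℝ, 0 < ε ∧ ∃ k₀ : ℕ, ∀ k m j : ℕ, k₀ ≤ k →
      a * k ≤ m → (m : ℝ) ≤ k / a → (j : ℝ) ≤ ε * k →
      |crossingProb half m k - crossingProb half (m + j) k| ≤ η :=
  stub_incrementLimit (stub_incrementBound stub_incrementExtraction stub_cornerArm)

/-- **H1 — no jump of the box-crossing limit** (T3 fed with `crossingProb_uniformIncrement`): if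
the bond-ℤ² crossing probability of every conformal rectangle converges as the mesh `δ → 0⁺` (to
`Φ`), then for every family `Q w` of boxes `(0,w) × (0,1)` crossed from the left side (arc `0`) to
the right side (arc `2`), `w ↦ Φ (Q w)` is continuous on `(0, ∞)`. [cite: SchrammSmirnov2011, Lemma 6.1]
[cite: BollobasRiordan2006, Ch. 7 §7.1] -/
theorem rectangleContinuity :
    ∀ Φ : ConformalRectangle → ℝ,
      (∀ R : ConformalRectangle, Tendsto (bondDomainCrossingProb R) (𝓝[>] (0 : ℝ)) (𝓝 (Φ R))) →
      ∀ Q : ℝ → ConformalRectangle,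
        (∀ w : ℝ, 0 < w → (Q w).carrier = (Ioo (0 : ℝ) w ×ℂ Ioo (0 : ℝ) 1) ∧
          (Q w).arc 0 = {z : ℂ | z.re = 0 ∧ z.im ∈ Icc (0 : ℝ) 1} ∧
          (Q w).arc 2 = {z : ℂ | z.re = w ∧ z.im ∈ Icc (0 : ℝ) 1}) →
        ContinuousOn (fun w => Φ (Q w)) (Ioi 0) :=
  stub_rectangleContinuity crossingProb_uniformIncrement

end Summit.CriticalPhenomena.CardyFormulaZ2.Cruxes.SimilarityUpgrade.Stubs

end
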